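import Literature.Analysis.FluidPDE.AnomalousDissipationAlternatingShears
import HarnessLib

/-!
# Elgindi–Liss 2024: proved bookkeeping for the typed statements

Companion (theorems only, no named facts) of `AnomalousDissipationAlternatingShears.lean`
(T. M. Elgindi, K. Liss, Arch. Ration. Mech. Anal. 248 (2024) = arXiv:2309.08576,
[`ElgindiLiss2024`]):

* the sawtooth shears are inverted by flipping the sign of the amplitude
  (`shearH_neg_comp`, `shearV_neg_comp`), whence `Φ_j⁻¹ ∘ Φ_j = id = Φ_j ∘ Φ_j⁻¹`
  (`PhiInv_comp_PhiMap`, `PhiMap_comp_PhiInv`) for the maps of §2.3 p. 9 — the typed `PhiInv` IS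
  the inverse of the typed `PhiMap`; the recursion of `flowInv` (`flowInv_zero`, `flowInv_succ`);
* the parameter identities of §2.2.2 p. 9: `K_j = α_j N_j t_j` (`amp_mul_freq_mul_dur`),
  positivity of `N_j, α_j, K_j, t_j` (`K_j ≥ 2` for `M > 0`, `j ≥ 1`), and the claim
  "`1 ≤ K_{j+1}/K_j ≤ 17` for any `j`" of the proof of Lemma 2.3 (p. 12) in the form
  `K_j ≤ K_{j+1} ≤ 8K_j` (`growthFactor_mono`, `growthFactor_succ_le`);
* `DissipatesAllSmoothData` forbids `κ_j ∫₀ᵀ ‖∇f_j‖² → 0` along any `κ_j → 0` for a non-zero datum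
  (`DissipatesAllSmoothData.not_tendsto_zero`) — the negation of the conclusion of the
  Obukhov–Corrsin barrier `DrivasElgindiIyerJeong2022_thm4` in its family form;
* Thm. 1's carrier lies in Thm. 2's class for every `0 < α < 1`
  (`IsUniformCarrier.continuousInHolderOn`).

## References

* T. M. Elgindi, K. Liss, arXiv:2309.08576v1, §2.2.1–§2.3 pp. 8–10, Thm. 1 p. 2. [`ElgindiLiss2024`]
-/

open MeasureTheory Set Filter Topology
open scoped ENNReal NNReal

noncomputable section

namespace Literature.Analysis.FluidPDE

namespace ElgindiLiss2024

variable {a : ℝ} {N : ℕ} {M : ℝ} {j : ℕ}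

/-- The horizontal shear does not move the `y`-coordinate. [cite: ElgindiLiss2024, §2.3 (φ_j) p. 9] -/
@[simp] theorem shearH_apply_one (a : ℝ) (N : ℕ) (z : UnitAddTorus (Fin 2)) :
    shearH a N z 1 = z 1 := by
  simp [shearH]

/-- The vertical shear does not move the `x`-coordinate. [cite: ElgindiLiss2024, §2.3 (ψ_j) p. 9] -/
@[simp] theorem shearV_apply_zero (a : ℝ) (N : ℕ) (z : UnitAddTorus (Fin 2)) :
    shearV a N z 0 = z 0 := by
  simp [shearV]

/-- The `x`-coordinate after the horizontal shear. [cite: ElgindiLiss2024, §2.3 (φ_j) p. 9] -/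
theorem shearH_apply_zero (a : ℝ) (N : ℕ) (z : UnitAddTorus (Fin 2)) :
    shearH a N z 0 = z 0 + ((a * ‖N • z 1‖ : ℝ) : UnitAddCircle) := by
  simp [shearH]

/-- The `y`-coordinate after the vertical shear. [cite: ElgindiLiss2024, §2.3 (ψ_j) p. 9] -/
theorem shearV_apply_one (a : ℝ) (N : ℕ) (z : UnitAddTorus (Fin 2)) :
    shearV a N z 1 = z 1 + ((a * ‖N • z 0‖ : ℝ) : UnitAddCircle) := by
  simp [shearV]

/-- `φ⁻¹ = (x - aS(Ny), y)`: the horizontal shear with amplitude `-a` inverts the one with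
amplitude `a`. [cite: ElgindiLiss2024, §2.3 (φ_j, Φ_j⁻¹) p. 9] -/
theorem shearH_neg_comp (a : ℝ) (N : ℕ) : shearH (-a) N ∘ shearH a N = id := by
  funext z
  simp only [Function.comp_apply, id_eq, shearH]
  have h1 : Function.update z 0 (z 0 + ((a * ‖N • z 1‖ : ℝ) : UnitAddCircle)) 1 = z 1 := by
    simp
  rw [h1]
  ext i
  fin_cases i
  · simp only [Function.update_self, Fin.zero_eta]
    rw [add_assoc, ← QuotientAddGroup.mk_add]
    simp
  · simp

/-- `ψ⁻¹ = (x, y - aS(Nx))`. [cite: ElgindiLiss2024, §2.3 (ψ_j, Φ_j⁻¹) p. 9] -/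
theorem shearV_neg_comp (a : ℝ) (N : ℕ) : shearV (-a) N ∘ shearV a N = id := by
  funext z
  simp only [Function.comp_apply, id_eq, shearV]
  have h1 : Function.update z 1 (z 1 + ((a * ‖N • z 0‖ : ℝ) : UnitAddCircle)) 0 = z 0 := by
    simp
  rw [h1]
  ext i
  fin_cases i
  · simp
  · simp only [Fin.mk_one]
    rw [Function.update_self, Function.update_self, add_assoc, ← QuotientAddGroup.mk_add]
    simp

/-- … and conversely. [cite: ElgindiLiss2024, §2.3 (φ_j) p. 9] -/
theorem shearH_comp_neg (a : ℝ) (N : ℕ) : shearH a N ∘ shearH (-a) N = id := by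
  simpa using shearH_neg_comp (-a) N

/-- … and conversely. [cite: ElgindiLiss2024, §2.3 (ψ_j) p. 9] -/
theorem shearV_comp_neg (a : ℝ) (N : ℕ) : shearV a N ∘ shearV (-a) N = id := by
  simpa using shearV_neg_comp (-a) N

/-- **`Φ_j⁻¹ ∘ Φ_j = id`**: the typed `PhiInv` is a left inverse of the typed `PhiMap`.
[cite: ElgindiLiss2024, §2.3 (Φ_j = ψ_j ∘ φ_j) p. 9] -/
theorem PhiInv_comp_PhiMap (M : ℝ) (j : ℕ) : PhiInv M j ∘ PhiMap M j = id := by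
  unfold PhiInv PhiMap phiMap psiMap
  rw [Function.comp_assoc, ← Function.comp_assoc (shearV _ _), shearV_neg_comp, Function.id_comp,
    shearH_neg_comp]

/-- **`Φ_j ∘ Φ_j⁻¹ = id`**: … and a right inverse. [cite: ElgindiLiss2024, §2.3 (Φ_j) p. 9] -/
theorem PhiMap_comp_PhiInv (M : ℝ) (j : ℕ) : PhiMap M j ∘ PhiInv M j = id := by
  unfold PhiInv PhiMap phiMap psiMap
  rw [Function.comp_assoc, ← Function.comp_assoc (shearH _ _), shearH_comp_neg, Function.id_comp,
    shearV_comp_neg]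

/-- `Φ_j` is a bijection of the torus. [cite: ElgindiLiss2024, §2.3 ("homeomorphisms") p. 9] -/
theorem PhiMap_bijective (M : ℝ) (j : ℕ) : Function.Bijective (PhiMap M j) :=
  ⟨Function.LeftInverse.injective (g := PhiInv M j) (fun z => congrFun (PhiInv_comp_PhiMap M j) z),
    Function.RightInverse.surjective (g := PhiInv M j) (fun z => congrFun (PhiMap_comp_PhiInv M j) z)⟩

/-- `flowInv M 0 = id` (`f_0 = f₀`). [cite: ElgindiLiss2024, §2.3 p. 9] -/
theorem flowInv_zero (M : ℝ) : flowInv M 0 = id := rfl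

/-- `flowInv M (j+1) = flowInv M j ∘ Φ_{j+1}⁻¹` (`f_{j+1} = f_j ∘ Φ_{j+1}⁻¹`).
[cite: ElgindiLiss2024, §2.3 p. 9] -/
theorem flowInv_succ (M : ℝ) (j : ℕ) : flowInv M (j + 1) = flowInv M j ∘ PhiInv M (j + 1) := rfl

/-- `f_1 = f₀ ∘ Φ_1⁻¹`. [cite: ElgindiLiss2024, §2.3 p. 9] -/
theorem flowInv_one (M : ℝ) : flowInv M 1 = PhiInv M 1 := by
  rw [flowInv_succ, flowInv_zero, Function.id_comp]

/-! ### The parameters of §2.2.2 -/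

/-- `N_j ≥ 1`. [cite: ElgindiLiss2024, §2.2.2 p. 9] -/
theorem one_le_freq (j : ℕ) : 1 ≤ freq j := Nat.one_le_two_pow

/-- `α_j > 0`. [cite: ElgindiLiss2024, §2.2.2 p. 9] -/
theorem amp_pos (j : ℕ) : 0 < amp j := by
  unfold amp
  positivity

/-- `K_j ≥ 0`. [cite: ElgindiLiss2024, §2.2.2 p. 9] -/
theorem growthFactor_nonneg (M : ℝ) (j : ℕ) : 0 ≤ growthFactor M j := by
  unfold growthFactor
  positivity

/-- `K_j ≥ 2` for `M > 0` and `j ≥ 1` (`K_j = 2⌈Mj^{5/2}⌉` is a positive even integer).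
[cite: ElgindiLiss2024, §2.2.2 p. 9] -/
theorem two_le_growthFactor (hM : 0 < M) (hj : 1 ≤ j) : 2 ≤ growthFactor M j := by
  unfold growthFactor
  have hpos : 0 < M * (j : ℝ) ^ (5 / 2 : ℝ) := by
    have : (0 : ℝ) < j := by exact_mod_cast hj
    positivity
  have h1 : (1 : ℝ) ≤ (⌈M * (j : ℝ) ^ (5 / 2 : ℝ)⌉₊ : ℝ) := by
    exact_mod_cast Nat.one_le_iff_ne_zero.2 (Nat.pos_iff_ne_zero.1 (Nat.ceil_pos.2 hpos))
  linarith

/-- `K_j > 0` for `M > 0`, `j ≥ 1`. [cite: ElgindiLiss2024, §2.2.2 p. 9] -/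
theorem growthFactor_pos (hM : 0 < M) (hj : 1 ≤ j) : 0 < growthFactor M j :=
  lt_of_lt_of_le two_pos (two_le_growthFactor hM hj)

/-- `t_j > 0` for `M > 0`, `j ≥ 1`. [cite: ElgindiLiss2024, §2.2.2 p. 9] -/
theorem dur_pos (hM : 0 < M) (hj : 1 ≤ j) : 0 < dur M j := by
  unfold dur
  have h1 := growthFactor_pos hM hj
  have h2 := amp_pos j
  have h3 : (0 : ℝ) < (freq j : ℝ) := by exact_mod_cast one_le_freq j
  positivity

/-- **`K_j = α_j N_j t_j`** ("we define `K_j := α_jN_jt_j = 2⌈Mj^{5/2}⌉`").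
[cite: ElgindiLiss2024, §2.2.2 p. 9] -/
theorem amp_mul_freq_mul_dur (M : ℝ) (j : ℕ) : amp j * freq j * dur M j = growthFactor M j := by
  unfold dur
  have h2 := (amp_pos j).ne'
  have h3 : (freq j : ℝ) ≠ 0 := by
    have : (0 : ℝ) < (freq j : ℝ) := by exact_mod_cast one_le_freq j
    exact this.ne'
  field_simp

/-- The shift amplitude of the `j`-th shears is `α_jt_j = K_j/N_j`.
[cite: ElgindiLiss2024, §2.3 p. 9] -/
theorem amp_mul_dur (M : ℝ) (j : ℕ) : amp j * dur M j = growthFactor M j / freq j := by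
  have h3 : (freq j : ℝ) ≠ 0 := by
    have : (0 : ℝ) < (freq j : ℝ) := by exact_mod_cast one_le_freq j
    exact this.ne'
  rw [eq_div_iff h3, ← amp_mul_freq_mul_dur M j]
  ring


/-- `K_j` is non-decreasing in `j` (for `M ≥ 0`): the lower half of "`1 ≤ K_{j+1}/K_j ≤ 17` for any
`j`". [cite: ElgindiLiss2024, §2.3 proof of Lemma 2.3, p. 12] -/
theorem growthFactor_mono (hM : 0 ≤ M) (j : ℕ) : growthFactor M j ≤ growthFactor M (j + 1) := by
  unfold growthFactor
  have h : M * (j : ℝ) ^ (5 / 2 : ℝ) ≤ M * ((j + 1 : ℕ) : ℝ) ^ (5 / 2 : ℝ) := by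
    apply mul_le_mul_of_nonneg_left _ hM
    exact Real.rpow_le_rpow (Nat.cast_nonneg j) (by push_cast; linarith) (by norm_num)
  have h2 : (⌈M * (j : ℝ) ^ (5 / 2 : ℝ)⌉₊ : ℝ) ≤ (⌈M * ((j + 1 : ℕ) : ℝ) ^ (5 / 2 : ℝ)⌉₊ : ℝ) := by
    exact_mod_cast Nat.ceil_mono h
  linarith

/-- `K_{j+1} ≤ 8 K_j` for `j ≥ 1` (`M ≥ 0`), from `(j+1)^{5/2} ≤ (2j)^{5/2} ≤ 8 j^{5/2}` and
`⌈8x⌉ ≤ 8⌈x⌉` — in particular the upper half of "`1 ≤ K_{j+1}/K_j ≤ 17` for any `j`" used in the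
proof of Lemma 2.3. [cite: ElgindiLiss2024, §2.3 proof of Lemma 2.3, p. 12] -/
theorem growthFactor_succ_le (hM : 0 ≤ M) (hj : 1 ≤ j) :
    growthFactor M (j + 1) ≤ 8 * growthFactor M j := by
  unfold growthFactor
  have hj' : (1 : ℝ) ≤ j := by exact_mod_cast hj
  have hx0 : 0 ≤ M * (j : ℝ) ^ (5 / 2 : ℝ) := by positivity
  -- (j+1)^{5/2} ≤ (2j)^{5/2} = 2^{5/2} j^{5/2} ≤ 8 j^{5/2}
  have h1 : ((j + 1 : ℕ) : ℝ) ^ (5 / 2 : ℝ) ≤ 8 * (j : ℝ) ^ (5 / 2 : ℝ) := by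
    have ha : ((j + 1 : ℕ) : ℝ) ≤ 2 * j := by push_cast; linarith
    have hb : ((j + 1 : ℕ) : ℝ) ^ (5 / 2 : ℝ) ≤ (2 * (j : ℝ)) ^ (5 / 2 : ℝ) :=
      Real.rpow_le_rpow (by positivity) ha (by norm_num)
    have hc : (2 * (j : ℝ)) ^ (5 / 2 : ℝ) = (2 : ℝ) ^ (5 / 2 : ℝ) * (j : ℝ) ^ (5 / 2 : ℝ) :=
      Real.mul_rpow (by norm_num) (by positivity)
    have hd : (2 : ℝ) ^ (5 / 2 : ℝ) ≤ 8 := by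
      calc (2 : ℝ) ^ (5 / 2 : ℝ) ≤ (2 : ℝ) ^ (3 : ℝ) :=
            Real.rpow_le_rpow_of_exponent_le (by norm_num) (by norm_num)
        _ = 8 := by
            rw [show (3 : ℝ) = ((3 : ℕ) : ℝ) by norm_num, Real.rpow_natCast]
            norm_num
    have he : 0 ≤ (j : ℝ) ^ (5 / 2 : ℝ) := by positivity
    calc ((j + 1 : ℕ) : ℝ) ^ (5 / 2 : ℝ) ≤ (2 : ℝ) ^ (5 / 2 : ℝ) * (j : ℝ) ^ (5 / 2 : ℝ) := by
          rw [← hc]; exact hb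
      _ ≤ 8 * (j : ℝ) ^ (5 / 2 : ℝ) := mul_le_mul_of_nonneg_right hd he
  -- hence M(j+1)^{5/2} ≤ 8 ⌈M j^{5/2}⌉, an integer, so the ceiling is bounded by it
  have h2 : M * ((j + 1 : ℕ) : ℝ) ^ (5 / 2 : ℝ) ≤ ((8 * ⌈M * (j : ℝ) ^ (5 / 2 : ℝ)⌉₊ : ℕ) : ℝ) := by
    have hceil : M * (j : ℝ) ^ (5 / 2 : ℝ) ≤ (⌈M * (j : ℝ) ^ (5 / 2 : ℝ)⌉₊ : ℝ) := Nat.le_ceil _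
    calc M * ((j + 1 : ℕ) : ℝ) ^ (5 / 2 : ℝ) ≤ M * (8 * (j : ℝ) ^ (5 / 2 : ℝ)) :=
          mul_le_mul_of_nonneg_left h1 hM
      _ = 8 * (M * (j : ℝ) ^ (5 / 2 : ℝ)) := by ring
      _ ≤ 8 * (⌈M * (j : ℝ) ^ (5 / 2 : ℝ)⌉₊ : ℝ) := by linarith
      _ = ((8 * ⌈M * (j : ℝ) ^ (5 / 2 : ℝ)⌉₊ : ℕ) : ℝ) := by push_cast; ring
  have h3 : ⌈M * ((j + 1 : ℕ) : ℝ) ^ (5 / 2 : ℝ)⌉₊ ≤ 8 * ⌈M * (j : ℝ) ^ (5 / 2 : ℝ)⌉₊ :=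
    Nat.ceil_le.2 h2
  have h4 : (⌈M * ((j + 1 : ℕ) : ℝ) ^ (5 / 2 : ℝ)⌉₊ : ℝ) ≤ 8 * (⌈M * (j : ℝ) ^ (5 / 2 : ℝ)⌉₊ : ℝ) := by
    exact_mod_cast h3
  linarith

/-! ### Consequences of the clause predicates -/

/-- Anomalous dissipation of all smooth data forbids `κ_j ∫₀ᵀ ‖∇f_j‖² → 0` along any `κ_j → 0⁺`
for a datum with `‖f₀‖_{L²} ≠ 0` — the negation of the family conclusion of the Obukhov–Corrsin
barrier (`DrivasElgindiIyerJeong2022_thm4.noAnomalousScalarDissipation`).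
[cite: ElgindiLiss2024, Thm. 1 p. 2 with (3) p. 2] -/
theorem DissipatesAllSmoothData.not_tendsto_zero {T : ℝ}
    {u : ℝ → UnitAddTorus (Fin 2) → EuclideanSpace ℝ (Fin 2)} (h : DissipatesAllSmoothData T u)
    {f₀ : UnitAddTorus (Fin 2) → ℝ} (hf₀ : FunctionSpaces.Torus.IsSmooth f₀)
    (hmean : FunctionSpaces.Torus.HasZeroMean f₀) (hne : 0 < Torus.scalarL2Sq f₀)
    {κ : ℕ → ℝ} (hκ : ∀ j, 0 < κ j) (hκ0 : Tendsto κ atTop (𝓝 0))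
    {f : ℕ → ℝ → UnitAddTorus (Fin 2) → ℝ}
    (hf : ∀ j, Torus.IsWeakScalarTransportOn T (κ j) u f₀ (f j)) :
    ¬ Tendsto (fun j => Torus.eScalarDissipation (κ j) (f j) 0 T) atTop (𝓝 0) := by
  obtain ⟨c, hc, hall⟩ := h f₀ hf₀ hmean
  have hev := hall κ hκ hκ0 f hf
  intro hlim
  have hpos : (0 : ℝ≥0∞) < ENNReal.ofReal (c * Torus.scalarL2Sq f₀) := by
    rw [ENNReal.ofReal_pos]; positivity
  have hsmall : ∀ᶠ j in atTop,
      Torus.eScalarDissipation (κ j) (f j) 0 T < ENNReal.ofReal (c * Torus.scalarL2Sq f₀) :=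
    (tendsto_order.1 hlim).2 _ hpos
  obtain ⟨j, hj1, hj2⟩ := (hev.and hsmall).exists
  exact absurd hj1 (not_le.2 hj2)

/-- Thm. 1's carrier lies in the class of Thm. 2 for every `0 < α < 1` (projection).
[cite: ElgindiLiss2024, Thm. 1 p. 2] -/
theorem IsUniformCarrier.continuousInHolderOn {T : ℝ}
    {u : ℝ → UnitAddTorus (Fin 2) → EuclideanSpace ℝ (Fin 2)} (h : IsUniformCarrier T u)
    {α : ℝ≥0} (hα0 : 0 < α) (hα : α < 1) :
    FunctionSpaces.ContinuousInHolderOn (Icc 0 T) α u :=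
  h.2.1 α hα0 hα

/-- Thm. 1's carrier is weakly divergence free at every `t ∈ [0,T]` (projection).
[cite: ElgindiLiss2024, Thm. 1 p. 2] -/
theorem IsUniformCarrier.isWeaklyDivFree {T : ℝ}
    {u : ℝ → UnitAddTorus (Fin 2) → EuclideanSpace ℝ (Fin 2)} (h : IsUniformCarrier T u)
    {t : ℝ} (ht : t ∈ Icc 0 T) : FunctionSpaces.Torus.IsWeaklyDivFree (u t) :=
  h.1 t ht

end ElgindiLiss2024

end Literature.Analysis.FluidPDE

end
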